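import Literature.MathematicalPhysics.QuantumFieldTheory.Balaban1983to89.Beta.DecimatedMomentSummable

/-!
# Bałaban's lattice YM₄ RG programme — β-function sub-cell: EXPONENTIALLY LOCALISED KERNEL CALCULUS ON `ℤ^D`
# (lead lineage strat-b12, gen 9; the generic «(T-sum)» half of brick (T-def) of BETA/AN2.md §13.3/§15.4 — RULING (R18-3))
# versions: v1 p185600 ac60706407a0 (§1–§5); v1.1 p185630 bf52d55bd338 (+§6); v1.2 (this file) DOCSTRING-ONLY: `abs_bubble_le`'s rate sentence
# corrected per XREAD C-lit3g17-5 D1 — every declaration byte-identical to v1.1.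
# v1.3 (this file) APPEND-ONLY §7: `decay510_mono_const`, `decay510_hessKer_uniform`, `hdec_hessKer` (ONE constant for all sixteen channels) — the `hdec` slot of
# `ScalewiseVectorSeam.endpointExistence_of_scalewise_vectorSeam_printed` (v1.3) for kernels of the form `hessKer A V W`.

HONEST FRAMING (cell rule, verbatim): «discharging `BetaPertH` makes Bałaban's UV stability UNCONDITIONAL — a real constructive-QFT
result; it is NOT the continuum limit and NOT the Clay problem.»  This module is [folklore] analysis on `ℤ^D`; it formalises NO statement
printed in Bałaban's papers, cites none, mints no Prop fact, and DISCHARGES NOTHING of the wall.  NOT summit progress.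

## Why (context only; asserted nowhere below)

Brick (T-def) of the β sub-cell (AN2.md §13.3, C-an2-47): the one-shot one-loop Hessian kernel of the typed U = 1 system is, by the resolvent
formula for the second variation of `log det` of a bordered operator family `𝕂(B)`,
`𝒯((μ,y),(ν,y′)) = ½ Tr[𝕂⁻¹ ∂²_{μy,νy′}𝕂] − ½ Tr[𝕂⁻¹ ∂_{μy}𝕂 𝕂⁻¹ ∂_{νy′}𝕂]`, «every trace an absolutely convergent lattice sum by
`decay_Gam` × locality of the vertices».  This file supplies exactly that convergence/decay bookkeeping, ABSTRACTLY: matrix-fibred kernels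
`A x y : F → F → ℝ` on `ℤ^D` (`F` a finite fibre: bond directions ⊕ multiplier components ⊕ …), an exponentially DECAYING kernel `A`
(`Decays A C δ`: `|A x y a b| ≤ C e^{−δ|x−y|₁}` — the bordered inverse, e.g. an2's `KKTFluctuationKernel.Gam` by `decay_Gam`), and vertex kernels
BI-LOCALISED at lattice points (`BiLoc K p q C δ`: `|K x y a b| ≤ C e^{−δ(|x−p|₁+|y−q|₁)}` — the first/second `B`-jets of `𝕂` at the coarse
bonds sitting at `p = N•y`, `q = N•y′`).  WHAT IS PROVED ([folklore]):
* §1 the lattice constant `Zl D c = Σ_x e^{−c|x|₁}` (finite, positive) and the shifted sums;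
* §2 `comp A K` (composition, a `tsum` over the middle site with the finite fibre sum inside) of a decaying and a bi-localised kernel is
  bi-localised at the same points with rate `δ′ < δ` (`biLoc_comp_decays`); the composition of two bi-localised kernels is bi-localised and
  SMALL in the distance of the inner points (`biLoc_comp_biLoc`); every defining series is absolutely convergent (`summable_…`);
* §3 the trace `tr K = Σ_x Σ_a K x x a a` of a bi-localised kernel converges absolutely and is `≤ C·|F|·Zl(δ/2)·e^{−(δ/2)|p−q|₁}` (`abs_tr_le`);
* §4 the BUBBLE `tr (comp (comp A V) (comp A W))` and the TADPOLE `tr (comp A W₂)` obey explicit exponential bounds in the distance of the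
  localisation points (`abs_bubble_le`, `abs_tadpole_le`);
* §5 for vertex FAMILIES indexed by coarse bonds `(μ, y)`, localised at `N • y`, the resolvent kernel
  `hessKer A V W μ ν z := ½·tadpole(W μ 0 ν z) − ½·bubble(V μ 0, V ν z)` is a `DressedMomentNormalisation.EKer`-shaped object
  (`Fin D → Fin D → (Fin D → ℤ) → ℝ`) with `Decay510 (hessKer … μ ν) C′ (δ/4)` for an explicit `C′ ≥ 0` assembled from the §4 constants
  (`decay510_hessKer`, stated with `∃ C′`) and hence `AbsMoment₂` (`absMoment₂_hessKer`) — the (T-def) slot `𝒯 : EKer 4` of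
  `HidentScalewise` / `ScalewiseVectorSeam` is thereby WELL-TYPED for any such data, with its `AbsMoment₂` hypothesis discharged.
* §6 (v1.1) block-translation covariance: under `BlockCovariant A V W N` (`A` invariant under simultaneous coarse shifts, the vertex
  families shifting with their coarse bond) the general two-point object `hess μ y ν y′` depends on `y′ − y` only and equals
  `hessKer μ ν (y′ − y)` (`hess_translate`, `hess_eq_hessKer`) — so the base point `0` represents every base point.
* §7 (v1.3) `decay510_hessKer_uniform` / `hdec_hessKer`: ONE decay constant for all channels (the `hdec` slot of
  `ScalewiseVectorSeam.endpointExistence_of_scalewise_vectorSeam_printed`).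
WHAT IS NOT HERE: the DEFINITION of Bałaban's vertex families (brick (V)/(V-H)/(V-Δ)/(V-J), an2/an3/an1), the (T0)/(T1) symmetries, the
identification of `hessKer` with a finite-volume second derivative of `log Z` ((ii-a′)), and every `N`-uniform statement.
-/

noncomputable section

open Finset Filter Topology
open scoped BigOperators

namespace Literature.MathematicalPhysics.QuantumFieldTheory.Balaban1983to89.Beta.ExpKernelCalculus

open Literature.MathematicalPhysics.QuantumFieldTheory.Balaban1983to89.B12Sec2to5 (l1 l1_nonneg Decay510 summable_exp_neg_l1)
open Literature.MathematicalPhysics.QuantumFieldTheory.Balaban1983to89.Beta.DecimatedMomentSummable (AbsMoment₂ absMoment₂_of_decay510)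

variable {D : ℕ} {F : Type*} [Fintype F]

/-- Sites of `ℤ^D`. [folklore] -/
abbrev Site (D : ℕ) : Type := Fin D → ℤ

/-- Matrix-fibred kernels on `ℤ^D`: `A x y a b`. [folklore] -/
abbrev MKer (D : ℕ) (F : Type*) : Type _ := Site D → Site D → F → F → ℝ

/-! ## §1 `ℓ¹` bookkeeping and the lattice constant -/

/-- Triangle inequality in the subtractive form `|x − z|₁ ≤ |x − y|₁ + |y − z|₁`. [folklore] -/
theorem l1_sub_triangle (x y z : Site D) : l1 (x - z) ≤ l1 (x - y) + l1 (y - z) := by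
  unfold l1
  rw [← Finset.sum_add_distrib]
  refine Finset.sum_le_sum fun i _ => ?_
  have : ((x - z) i : ℝ) = ((x - y) i : ℝ) + ((y - z) i : ℝ) := by push_cast [Pi.sub_apply]; ring
  rw [this]
  exact abs_add_le _ _

/-- `|x − y|₁ = |y − x|₁`. [folklore] -/
theorem l1_sub_symm (x y : Site D) : l1 (x - y) = l1 (y - x) := by
  unfold l1
  refine Finset.sum_congr rfl fun i _ => ?_
  rw [show ((x - y) i : ℝ) = -((y - x) i : ℝ) by push_cast [Pi.sub_apply]; ring, abs_neg]

/-- `|N • z|₁ = N · |z|₁`. [folklore] -/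
theorem l1_natSmul (N : ℕ) (z : Site D) : l1 ((N : ℤ) • z) = (N : ℝ) * l1 z := by
  unfold l1
  rw [Finset.mul_sum]
  refine Finset.sum_congr rfl fun i _ => ?_
  rw [show (((N : ℤ) • z) i : ℝ) = (N : ℝ) * (z i : ℝ) by simp [Pi.smul_apply], abs_mul, abs_of_nonneg (Nat.cast_nonneg N)]

/-- The lattice constant `Zl D c = Σ_{x ∈ ℤ^D} e^{−c|x|₁}`. [folklore] -/
def Zl (D : ℕ) (c : ℝ) : ℝ := ∑' x : Site D, Real.exp (-c * l1 x)

/-- `Zl` is positive. [folklore] -/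
theorem Zl_pos {c : ℝ} (hc : 0 < c) : 0 < Zl D c := by
  unfold Zl
  exact (summable_exp_neg_l1 hc D).tsum_pos (fun _ => (Real.exp_pos _).le) 0 (Real.exp_pos _)

/-- `Zl` is nonnegative. [folklore] -/
theorem Zl_nonneg {c : ℝ} (hc : 0 < c) : 0 ≤ Zl D c := (Zl_pos hc).le

/-- Shifted summability: `y ↦ e^{−c|x − y|₁}` is summable. [folklore] -/
theorem summable_exp_shift {c : ℝ} (hc : 0 < c) (x : Site D) : Summable fun y : Site D => Real.exp (-c * l1 (x - y)) := by
  have h := (Equiv.subLeft x).summable_iff.mpr (summable_exp_neg_l1 hc D)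
  refine h.congr fun y => ?_
  simp [Equiv.subLeft]

/-- Shifted summability, primed orientation. [folklore] -/
theorem summable_exp_shift' {c : ℝ} (hc : 0 < c) (x : Site D) : Summable fun y : Site D => Real.exp (-c * l1 (y - x)) := by
  refine (summable_exp_shift hc x).congr fun y => ?_
  rw [l1_sub_symm]

/-- Shifted sum: `Σ_y e^{−c|x − y|₁} = Zl D c`. [folklore] -/
theorem tsum_exp_shift {c : ℝ} (x : Site D) : ∑' y : Site D, Real.exp (-c * l1 (x - y)) = Zl D c := by
  unfold Zl
  rw [← (Equiv.subLeft x).tsum_eq (fun y : Site D => Real.exp (-c * l1 y))]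
  rfl

/-- Shifted sum, other orientation: `Σ_y e^{−c|y − x|₁} = Zl D c`. [folklore] -/
theorem tsum_exp_shift' {c : ℝ} (x : Site D) : ∑' y : Site D, Real.exp (-c * l1 (y - x)) = Zl D c := by
  rw [← tsum_exp_shift (c := c) x]
  exact tsum_congr fun y => by rw [l1_sub_symm]

/-! ## §2 Decaying and bi-localised kernels; composition -/

/-- EXPONENTIAL DECAY of a kernel: `|A x y a b| ≤ C e^{−δ|x−y|₁}`. [folklore] -/
def Decays (A : MKer D F) (C δ : ℝ) : Prop := ∀ x y a b, |A x y a b| ≤ C * Real.exp (-δ * l1 (x - y))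

/-- BI-LOCALISATION of a kernel at the points `(p, q)`: `|K x y a b| ≤ C e^{−δ(|x−p|₁ + |y−q|₁)}`. [folklore] -/
def BiLoc (K : MKer D F) (p q : Site D) (C δ : ℝ) : Prop :=
  ∀ x y a b, |K x y a b| ≤ C * Real.exp (-δ * (l1 (x - p) + l1 (y - q)))

omit [Fintype F] in
/-- The constant of a `Decays` bound is nonnegative (if the fibre is inhabited). [folklore] -/
theorem Decays.nonneg {A : MKer D F} {C δ : ℝ} (h : Decays A C δ) (a : F) : 0 ≤ C := by
  have := h 0 0 a a
  have h1 : Real.exp (-δ * l1 ((0 : Site D) - 0)) = 1 := by simp [l1]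
  rw [h1, mul_one] at this
  exact (abs_nonneg _).trans this

omit [Fintype F] in
/-- The constant of a `BiLoc` bound is nonnegative (if the fibre is inhabited). [folklore] -/
theorem BiLoc.nonneg {K : MKer D F} {p q : Site D} {C δ : ℝ} (h : BiLoc K p q C δ) (a : F) : 0 ≤ C := by
  have := h p q a a
  have h1 : Real.exp (-δ * (l1 (p - p) + l1 (q - q))) = 1 := by simp [l1]
  rw [h1, mul_one] at this
  exact (abs_nonneg _).trans this

/-- COMPOSITION of two kernels: `(A ∘ K)(x, z)_{ab} = Σ'_y Σ_f A(x,y)_{af} K(y,z)_{fb}`. [folklore] -/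
def comp (A K : MKer D F) : MKer D F := fun x z a b => ∑' y : Site D, ∑ f, A x y a f * K y z f b

/-- The key exponent split: `e^{−δ|x−y|} e^{−δ|y−p|} ≤ e^{−(δ−δ′)|x−y|} e^{−δ′|x−p|}` for `0 ≤ δ′ ≤ δ`. [folklore] -/
theorem exp_split {δ δ' : ℝ} (h0 : 0 ≤ δ') (h1 : δ' ≤ δ) (x y p : Site D) :
    Real.exp (-δ * l1 (x - y)) * Real.exp (-δ * l1 (y - p)) ≤
      Real.exp (-(δ - δ') * l1 (x - y)) * Real.exp (-δ' * l1 (x - p)) := by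
  rw [← Real.exp_add, ← Real.exp_add, Real.exp_le_exp]
  have ht := l1_sub_triangle x y p
  have ha := l1_nonneg (x - y)
  have hb := l1_nonneg (y - p)
  nlinarith [mul_nonneg h0 (show 0 ≤ l1 (x - y) + l1 (y - p) - l1 (x - p) by linarith),
    mul_nonneg (show 0 ≤ δ - δ' by linarith) hb]

/-- The midpoint split: `e^{−δ(|y−p| + |y−q|)} ≤ e^{−(δ/2)|p−q|} e^{−(δ/2)|y−p|}` for `δ ≥ 0`. [folklore] -/
theorem exp_mid {δ : ℝ} (hδ : 0 ≤ δ) (y p q : Site D) :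
    Real.exp (-δ * (l1 (y - p) + l1 (y - q))) ≤ Real.exp (-(δ / 2) * l1 (p - q)) * Real.exp (-(δ / 2) * l1 (y - p)) := by
  rw [← Real.exp_add, Real.exp_le_exp]
  have ht : l1 (p - q) ≤ l1 (y - p) + l1 (y - q) := by
    have := l1_sub_triangle p y q
    rw [l1_sub_symm p y] at this
    exact this
  have ha := l1_nonneg (y - p)
  have hb := l1_nonneg (y - q)
  nlinarith

/-- Termwise bound for `comp A K` with `A` decaying and `K` bi-localised: the summand at `y` is
`≤ |F|·C·C′·e^{−δ|z−q|}·e^{−δ′|x−p|}·e^{−(δ−δ′)|x−y|}`. [folklore] -/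
theorem abs_compTerm_le {A K : MKer D F} {C C' δ δ' : ℝ} (hA : Decays A C δ) {p q : Site D} (hK : BiLoc K p q C' δ)
    (h0 : 0 ≤ δ') (h1 : δ' ≤ δ) (x z : Site D) (a b : F) (y : Site D) :
    |∑ f, A x y a f * K y z f b| ≤
      (Fintype.card F : ℝ) * (C * C') * Real.exp (-δ * l1 (z - q)) * Real.exp (-δ' * l1 (x - p)) *
        Real.exp (-(δ - δ') * l1 (x - y)) := by
  classical
  have hCC : 0 ≤ C * C' := mul_nonneg (hA.nonneg a) (hK.nonneg a)
  have hC : ∀ f, |A x y a f * K y z f b| ≤ (C * C') * Real.exp (-δ * l1 (z - q)) * Real.exp (-δ' * l1 (x - p)) *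
      Real.exp (-(δ - δ') * l1 (x - y)) := by
    intro f
    rw [abs_mul]
    have h2 := hA x y a f
    have h3 := hK y z f b
    calc |A x y a f| * |K y z f b|
        ≤ (C * Real.exp (-δ * l1 (x - y))) * (C' * Real.exp (-δ * (l1 (y - p) + l1 (z - q)))) :=
          mul_le_mul h2 h3 (abs_nonneg _) ((abs_nonneg _).trans h2)
      _ = (C * C') * Real.exp (-δ * l1 (z - q)) * (Real.exp (-δ * l1 (x - y)) * Real.exp (-δ * l1 (y - p))) := by
          rw [show -δ * (l1 (y - p) + l1 (z - q)) = -δ * l1 (y - p) + -δ * l1 (z - q) by ring, Real.exp_add]; ring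
      _ ≤ (C * C') * Real.exp (-δ * l1 (z - q)) * (Real.exp (-(δ - δ') * l1 (x - y)) * Real.exp (-δ' * l1 (x - p))) :=
          mul_le_mul_of_nonneg_left (exp_split h0 h1 x y p) (by positivity)
      _ = (C * C') * Real.exp (-δ * l1 (z - q)) * Real.exp (-δ' * l1 (x - p)) * Real.exp (-(δ - δ') * l1 (x - y)) := by ring
  calc |∑ f, A x y a f * K y z f b| ≤ ∑ f, |A x y a f * K y z f b| := Finset.abs_sum_le_sum_abs _ _
    _ ≤ ∑ _f : F, (C * C') * Real.exp (-δ * l1 (z - q)) * Real.exp (-δ' * l1 (x - p)) * Real.exp (-(δ - δ') * l1 (x - y)) :=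
        Finset.sum_le_sum fun f _ => hC f
    _ = _ := by rw [Finset.sum_const, Finset.card_univ, nsmul_eq_mul]; ring

/-- Summability of the composition series (decaying ∘ bi-localised). [folklore] -/
theorem summable_compTerm {A K : MKer D F} {C C' δ δ' : ℝ} (hA : Decays A C δ) {p q : Site D} (hK : BiLoc K p q C' δ)
    (h0 : 0 ≤ δ') (h1 : δ' < δ) (x z : Site D) (a b : F) :
    Summable fun y : Site D => ∑ f, A x y a f * K y z f b := by
  refine Summable.of_norm_bounded
    ((summable_exp_shift (show 0 < δ - δ' by linarith) x).mul_left
      ((Fintype.card F : ℝ) * (C * C') * Real.exp (-δ * l1 (z - q)) * Real.exp (-δ' * l1 (x - p)))) (fun y => ?_)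
  rw [Real.norm_eq_abs]
  exact abs_compTerm_le hA hK h0 h1.le x z a b y

/-- **DECAYING ∘ BI-LOCALISED IS BI-LOCALISED** (at the same points, any smaller rate `δ′ < δ`, constant `|F|·C·C′·Zl(δ−δ′)`). [folklore] -/
theorem biLoc_comp_decays {A K : MKer D F} {C C' δ δ' : ℝ} (hA : Decays A C δ) {p q : Site D} (hK : BiLoc K p q C' δ)
    (h0 : 0 ≤ δ') (h1 : δ' < δ) :
    BiLoc (comp A K) p q ((Fintype.card F : ℝ) * (C * C') * Zl D (δ - δ')) δ' := by
  intro x z a b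
  unfold comp
  have hs := summable_exp_shift (show 0 < δ - δ' by linarith) x
  have hmaj := hs.mul_left ((Fintype.card F : ℝ) * (C * C') * Real.exp (-δ * l1 (z - q)) * Real.exp (-δ' * l1 (x - p)))
  have hb := tsum_of_norm_bounded hmaj.hasSum
    (fun y => by rw [Real.norm_eq_abs]; exact abs_compTerm_le hA hK h0 h1.le x z a b y)
  rw [Real.norm_eq_abs] at hb
  refine hb.trans ?_
  rw [tsum_mul_left, tsum_exp_shift]
  have hCC : 0 ≤ (Fintype.card F : ℝ) * (C * C') * Zl D (δ - δ') :=
    mul_nonneg (mul_nonneg (Nat.cast_nonneg _) (mul_nonneg (hA.nonneg a) (hK.nonneg a))) (Zl_nonneg (by linarith))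
  have hzq : Real.exp (-δ * l1 (z - q)) ≤ Real.exp (-δ' * l1 (z - q)) := by
    rw [Real.exp_le_exp]; nlinarith [l1_nonneg (z - q)]
  calc (Fintype.card F : ℝ) * (C * C') * Real.exp (-δ * l1 (z - q)) * Real.exp (-δ' * l1 (x - p)) * Zl D (δ - δ')
      = ((Fintype.card F : ℝ) * (C * C') * Zl D (δ - δ')) * (Real.exp (-δ * l1 (z - q)) * Real.exp (-δ' * l1 (x - p))) := by ring
    _ ≤ ((Fintype.card F : ℝ) * (C * C') * Zl D (δ - δ')) * (Real.exp (-δ' * l1 (z - q)) * Real.exp (-δ' * l1 (x - p))) :=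
        mul_le_mul_of_nonneg_left (mul_le_mul_of_nonneg_right hzq (Real.exp_pos _).le) hCC
    _ = ((Fintype.card F : ℝ) * (C * C') * Zl D (δ - δ')) * Real.exp (-δ' * (l1 (x - p) + l1 (z - q))) := by
        rw [show -δ' * (l1 (x - p) + l1 (z - q)) = -δ' * l1 (z - q) + -δ' * l1 (x - p) by ring, Real.exp_add]

/-- Termwise bound for the composition of two bi-localised kernels (`K` at `(p, p′)`, `K′` at `(q′, q)`): the summand at `y` is
`≤ |F|·C·C′·e^{−δ(|x−p| + |z−q|)}·e^{−(δ/2)|p′−q′|}·e^{−(δ/2)|y−p′|}`. [folklore] -/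
theorem abs_compTerm_le₂ {K K' : MKer D F} {C C' δ : ℝ} {p p' q' q : Site D} (hK : BiLoc K p p' C δ) (hK' : BiLoc K' q' q C' δ)
    (hδ : 0 ≤ δ) (x z : Site D) (a b : F) (y : Site D) :
    |∑ f, K x y a f * K' y z f b| ≤
      (Fintype.card F : ℝ) * (C * C') * Real.exp (-δ * (l1 (x - p) + l1 (z - q))) * Real.exp (-(δ / 2) * l1 (p' - q')) *
        Real.exp (-(δ / 2) * l1 (y - p')) := by
  classical
  have hCC : 0 ≤ C * C' := mul_nonneg (hK.nonneg a) (hK'.nonneg a)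
  have hC : ∀ f, |K x y a f * K' y z f b| ≤ (C * C') * Real.exp (-δ * (l1 (x - p) + l1 (z - q))) *
      Real.exp (-(δ / 2) * l1 (p' - q')) * Real.exp (-(δ / 2) * l1 (y - p')) := by
    intro f
    rw [abs_mul]
    have h2 := hK x y a f
    have h3 := hK' y z f b
    calc |K x y a f| * |K' y z f b|
        ≤ (C * Real.exp (-δ * (l1 (x - p) + l1 (y - p')))) * (C' * Real.exp (-δ * (l1 (y - q') + l1 (z - q)))) :=
          mul_le_mul h2 h3 (abs_nonneg _) ((abs_nonneg _).trans h2)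
      _ = (C * C') * (Real.exp (-δ * (l1 (x - p) + l1 (y - p'))) * Real.exp (-δ * (l1 (y - q') + l1 (z - q)))) := by ring
      _ = (C * C') * (Real.exp (-δ * (l1 (x - p) + l1 (z - q))) * Real.exp (-δ * (l1 (y - p') + l1 (y - q')))) := by
          congr 1
          rw [← Real.exp_add, ← Real.exp_add]
          ring_nf
      _ = (C * C') * Real.exp (-δ * (l1 (x - p) + l1 (z - q))) * Real.exp (-δ * (l1 (y - p') + l1 (y - q'))) := by ring
      _ ≤ (C * C') * Real.exp (-δ * (l1 (x - p) + l1 (z - q))) *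
            (Real.exp (-(δ / 2) * l1 (p' - q')) * Real.exp (-(δ / 2) * l1 (y - p'))) :=
          mul_le_mul_of_nonneg_left (exp_mid hδ y p' q') (by positivity)
      _ = _ := by ring
  calc |∑ f, K x y a f * K' y z f b| ≤ ∑ f, |K x y a f * K' y z f b| := Finset.abs_sum_le_sum_abs _ _
    _ ≤ ∑ _f : F, (C * C') * Real.exp (-δ * (l1 (x - p) + l1 (z - q))) * Real.exp (-(δ / 2) * l1 (p' - q')) *
          Real.exp (-(δ / 2) * l1 (y - p')) := Finset.sum_le_sum fun f _ => hC f
    _ = _ := by rw [Finset.sum_const, Finset.card_univ, nsmul_eq_mul]; ring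

/-- Summability of the composition series (bi-localised ∘ bi-localised). [folklore] -/
theorem summable_compTerm₂ {K K' : MKer D F} {C C' δ : ℝ} {p p' q' q : Site D} (hK : BiLoc K p p' C δ) (hK' : BiLoc K' q' q C' δ)
    (hδ : 0 < δ) (x z : Site D) (a b : F) :
    Summable fun y : Site D => ∑ f, K x y a f * K' y z f b := by
  refine Summable.of_norm_bounded
    ((summable_exp_shift' (c := δ / 2) (by linarith) p').mul_left
      ((Fintype.card F : ℝ) * (C * C') * Real.exp (-δ * (l1 (x - p) + l1 (z - q))) * Real.exp (-(δ / 2) * l1 (p' - q'))))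
    (fun y => ?_)
  rw [Real.norm_eq_abs]
  exact abs_compTerm_le₂ hK hK' hδ.le x z a b y

/-- **BI-LOCALISED ∘ BI-LOCALISED IS BI-LOCALISED AND SMALL IN THE INNER DISTANCE**: `K` at `(p, p′)`, `K′` at `(q′, q)` ⟹ `K ∘ K′` at
`(p, q)` with constant `|F|·C·C′·Zl(δ/2)·e^{−(δ/2)|p′−q′|}`. [folklore] -/
theorem biLoc_comp_biLoc {K K' : MKer D F} {C C' δ : ℝ} {p p' q' q : Site D} (hK : BiLoc K p p' C δ) (hK' : BiLoc K' q' q C' δ)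
    (hδ : 0 < δ) :
    BiLoc (comp K K') p q ((Fintype.card F : ℝ) * (C * C') * Zl D (δ / 2) * Real.exp (-(δ / 2) * l1 (p' - q'))) δ := by
  intro x z a b
  unfold comp
  have hs := summable_exp_shift' (c := δ / 2) (by linarith) p'
  have hmaj := hs.mul_left
    ((Fintype.card F : ℝ) * (C * C') * Real.exp (-δ * (l1 (x - p) + l1 (z - q))) * Real.exp (-(δ / 2) * l1 (p' - q')))
  have hb := tsum_of_norm_bounded hmaj.hasSum
    (fun y => by rw [Real.norm_eq_abs]; exact abs_compTerm_le₂ hK hK' hδ.le x z a b y)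
  rw [Real.norm_eq_abs] at hb
  refine hb.trans (le_of_eq ?_)
  rw [tsum_mul_left, tsum_exp_shift']
  ring

/-! ## §3 The trace of a bi-localised kernel -/

/-- TRACE of a kernel: `Σ'_x Σ_a K x x a a`. [folklore] -/
def tr (K : MKer D F) : ℝ := ∑' x : Site D, ∑ a, K x x a a

/-- Termwise bound for the trace of a bi-localised kernel. [folklore] -/
theorem abs_trTerm_le {K : MKer D F} {C δ : ℝ} {p q : Site D} (hK : BiLoc K p q C δ) (hδ : 0 ≤ δ) (x : Site D) :
    |∑ a, K x x a a| ≤ (Fintype.card F : ℝ) * C * Real.exp (-(δ / 2) * l1 (p - q)) * Real.exp (-(δ / 2) * l1 (x - p)) := by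
  classical
  calc |∑ a, K x x a a| ≤ ∑ a, |K x x a a| := Finset.abs_sum_le_sum_abs _ _
    _ ≤ ∑ _a : F, C * Real.exp (-(δ / 2) * l1 (p - q)) * Real.exp (-(δ / 2) * l1 (x - p)) :=
        Finset.sum_le_sum fun a _ => (hK x x a a).trans (by
          rw [mul_assoc]
          exact mul_le_mul_of_nonneg_left (exp_mid hδ x p q) (hK.nonneg a))
    _ = _ := by rw [Finset.sum_const, Finset.card_univ, nsmul_eq_mul]; ring

/-- The trace series of a bi-localised kernel converges absolutely. [folklore] -/
theorem summable_trTerm {K : MKer D F} {C δ : ℝ} {p q : Site D} (hK : BiLoc K p q C δ) (hδ : 0 < δ) :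
    Summable fun x : Site D => ∑ a, K x x a a := by
  refine Summable.of_norm_bounded
    ((summable_exp_shift' (c := δ / 2) (by linarith) p).mul_left
      ((Fintype.card F : ℝ) * C * Real.exp (-(δ / 2) * l1 (p - q)))) (fun x => ?_)
  rw [Real.norm_eq_abs]
  exact abs_trTerm_le hK hδ.le x

/-- **THE TRACE OF A BI-LOCALISED KERNEL IS EXPONENTIALLY SMALL IN `|p − q|₁`**: `|tr K| ≤ |F|·C·Zl(δ/2)·e^{−(δ/2)|p−q|₁}`. [folklore] -/
theorem abs_tr_le {K : MKer D F} {C δ : ℝ} {p q : Site D} (hK : BiLoc K p q C δ) (hδ : 0 < δ) :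
    |tr K| ≤ (Fintype.card F : ℝ) * C * Zl D (δ / 2) * Real.exp (-(δ / 2) * l1 (p - q)) := by
  unfold tr
  have hs := summable_exp_shift' (c := δ / 2) (by linarith) p
  have hmaj := hs.mul_left ((Fintype.card F : ℝ) * C * Real.exp (-(δ / 2) * l1 (p - q)))
  have hb := tsum_of_norm_bounded hmaj.hasSum (fun x => by rw [Real.norm_eq_abs]; exact abs_trTerm_le hK hδ.le x)
  rw [Real.norm_eq_abs] at hb
  refine hb.trans (le_of_eq ?_)
  rw [tsum_mul_left, tsum_exp_shift']
  ring

/-! ## §4 Bubble and tadpole -/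

/-- The BUBBLE `Tr[(A∘V)(A∘W)]` for a decaying `A` and vertex kernels `V`, `W`. [folklore] -/
def bubble (A V W : MKer D F) : ℝ := tr (comp (comp A V) (comp A W))

/-- The TADPOLE `Tr[A∘W₂]` for a decaying `A` and a second-order vertex kernel `W₂`. [folklore] -/
def tadpole (A W₂ : MKer D F) : ℝ := tr (comp A W₂)

/-- **BUBBLE BOUND**: `V` bi-localised at `(p,p)`, `W` at `(q,q)`, `A` decaying at rate `δ` ⟹
`|bubble A V W| ≤ Cb · e^{−(δ/4)|p−q|₁}·e^{−(δ/4)|p−q|₁}` (combined rate `δ/2`) with an explicit `Cb`. [folklore]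
(v1.2 DOCFIX, XREAD C-lit3g17-5 D1: the second factor's rate read «δ/8» in v1/v1.1; the statement was and is `δ/2/2` twice.) -/
theorem abs_bubble_le {A V W : MKer D F} {C Cv Cw δ : ℝ} (hA : Decays A C δ) {p q : Site D} (hV : BiLoc V p p Cv δ)
    (hW : BiLoc W q q Cw δ) (hδ : 0 < δ) :
    |bubble A V W| ≤
      (Fintype.card F : ℝ) *
          ((Fintype.card F : ℝ) * (((Fintype.card F : ℝ) * (C * Cv) * Zl D (δ - δ / 2)) *
              ((Fintype.card F : ℝ) * (C * Cw) * Zl D (δ - δ / 2))) * Zl D (δ / 2 / 2) *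
            Real.exp (-(δ / 2 / 2) * l1 (p - q))) *
        Zl D (δ / 2 / 2) * Real.exp (-(δ / 2 / 2) * l1 (p - q)) := by
  have h1 : BiLoc (comp A V) p p ((Fintype.card F : ℝ) * (C * Cv) * Zl D (δ - δ / 2)) (δ / 2) :=
    biLoc_comp_decays hA hV (by linarith) (by linarith)
  have h2 : BiLoc (comp A W) q q ((Fintype.card F : ℝ) * (C * Cw) * Zl D (δ - δ / 2)) (δ / 2) :=
    biLoc_comp_decays hA hW (by linarith) (by linarith)
  have h3 := biLoc_comp_biLoc h1 h2 (by linarith : 0 < δ / 2)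
  exact abs_tr_le h3 (by linarith)

/-- **TADPOLE BOUND**: `W₂` bi-localised at `(p,q)`, `A` decaying ⟹ `|tadpole A W₂| ≤ Ct · e^{−(δ/4)|p−q|₁}`. [folklore] -/
theorem abs_tadpole_le {A W₂ : MKer D F} {C Cw δ : ℝ} (hA : Decays A C δ) {p q : Site D} (hW : BiLoc W₂ p q Cw δ) (hδ : 0 < δ) :
    |tadpole A W₂| ≤
      (Fintype.card F : ℝ) * ((Fintype.card F : ℝ) * (C * Cw) * Zl D (δ - δ / 2)) * Zl D (δ / 2 / 2) *
        Real.exp (-(δ / 2 / 2) * l1 (p - q)) := by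
  have h1 : BiLoc (comp A W₂) p q ((Fintype.card F : ℝ) * (C * Cw) * Zl D (δ - δ / 2)) (δ / 2) :=
    biLoc_comp_decays hA hW (by linarith) (by linarith)
  exact abs_tr_le h1 (by linarith)

/-! ## §5 Vertex families on the coarse lattice and the resolvent Hessian kernel -/

/-- A first-order VERTEX FAMILY: `V μ y` bi-localised at the coarse bond position `N • y` (both legs). [folklore] -/
def VertexFamily (V : Fin D → Site D → MKer D F) (N : ℕ) (Cv δ : ℝ) : Prop :=
  ∀ μ y, BiLoc (V μ y) ((N : ℤ) • y) ((N : ℤ) • y) Cv δ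

/-- A second-order VERTEX FAMILY: `W μ y ν y′` bi-localised at `(N • y, N • y′)`. [folklore] -/
def VertexFamily₂ (W : Fin D → Site D → Fin D → Site D → MKer D F) (N : ℕ) (Cw δ : ℝ) : Prop :=
  ∀ μ y ν y', BiLoc (W μ y ν y') ((N : ℤ) • y) ((N : ℤ) • y') Cw δ

/-- **THE RESOLVENT HESSIAN KERNEL** at base point `0`: `𝒯_{μν}(z) := ½·tadpole(W μ 0 ν z) − ½·bubble(V μ 0, V ν z)` — the shape of
the second variation of `−½ log det` (resp. `log Z`) of a bordered operator family in the coarse background, read as a matrix kernel on the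
coarse lattice (`DressedMomentNormalisation.EKer D` = `Fin D → Fin D → (Fin D → ℤ) → ℝ`). [folklore] -/
def hessKer (A : MKer D F) (V : Fin D → Site D → MKer D F) (W : Fin D → Site D → Fin D → Site D → MKer D F) :
    Fin D → Fin D → Site D → ℝ :=
  fun μ ν z => (1 / 2) * tadpole A (W μ 0 ν z) - (1 / 2) * bubble A (V μ 0) (V ν z)

/-- **(5.10)-SHAPE DECAY OF THE RESOLVENT HESSIAN KERNEL**: for a decaying `A` (rate `δ`) and vertex families localised at the coarse
bonds (blocking `N ≥ 1`), `|𝒯_{μν}(z)| ≤ C′ e^{−(δ/4)|z|₁}` for an explicit `C′ ≥ 0` (assembled from `abs_tadpole_le` / `abs_bubble_le`).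
[folklore] -/
theorem decay510_hessKer {A : MKer D F} {V : Fin D → Site D → MKer D F} {W : Fin D → Site D → Fin D → Site D → MKer D F}
    {C Cv Cw δ : ℝ} {N : ℕ} (hA : Decays A C δ) (hV : VertexFamily V N Cv δ) (hW : VertexFamily₂ W N Cw δ) (hδ : 0 < δ)
    (hN : 1 ≤ N) (μ ν : Fin D) :
    ∃ C' : ℝ, 0 ≤ C' ∧ Decay510 (hessKer A V W μ ν) C' (δ / 4) := by
  classical
  -- the two constants of §4 (tadpole with `Cw`, bubble with `Cv, Cv`)
  let cF : ℝ := Fintype.card F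
  let ZA : ℝ := Zl D (δ - δ / 2)
  let ZB : ℝ := Zl D (δ / 2 / 2)
  let Kt : ℝ := cF * (cF * (C * Cw) * ZA) * ZB
  let Kb : ℝ := cF * (cF * ((cF * (C * Cv) * ZA) * (cF * (C * Cv) * ZA)) * ZB) * ZB
  rcases isEmpty_or_nonempty F with hF | ⟨⟨a⟩⟩
  · -- empty fibre: the kernel vanishes identically
    refine ⟨0, le_rfl, fun z => ?_⟩
    have h0 : hessKer A V W μ ν z = 0 := by
      simp [hessKer, tadpole, bubble, tr, Finset.univ_eq_empty]
    rw [h0, abs_zero, zero_mul]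
  have hC := hA.nonneg a
  have hCv := (hV μ 0).nonneg a
  have hCw := (hW μ 0 ν 0).nonneg a
  have hZA : 0 ≤ ZA := Zl_nonneg (D := D) (show 0 < δ - δ / 2 by linarith)
  have hZB : 0 ≤ ZB := Zl_nonneg (D := D) (show 0 < δ / 2 / 2 by linarith)
  have hcF : 0 ≤ cF := Nat.cast_nonneg _
  have hKt : 0 ≤ Kt := by positivity
  have hKb : 0 ≤ Kb := by positivity
  refine ⟨1 / 2 * Kt + 1 / 2 * Kb, by positivity, fun z => ?_⟩
  have ht : |tadpole A (W μ 0 ν z)| ≤ Kt * Real.exp (-(δ / 2 / 2) * l1 (((N : ℤ) • (0 : Site D)) - (N : ℤ) • z)) :=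
    abs_tadpole_le hA (hW μ 0 ν z) hδ
  have hb : |bubble A (V μ 0) (V ν z)| ≤
      cF * (cF * ((cF * (C * Cv) * ZA) * (cF * (C * Cv) * ZA)) * ZB *
          Real.exp (-(δ / 2 / 2) * l1 (((N : ℤ) • (0 : Site D)) - (N : ℤ) • z))) * ZB *
        Real.exp (-(δ / 2 / 2) * l1 (((N : ℤ) • (0 : Site D)) - (N : ℤ) • z)) :=
    abs_bubble_le hA (hV μ 0) (hV ν z) hδ
  -- the distance of the localisation points: |N•0 − N•z|₁ = N |z|₁ ≥ |z|₁
  have hdist : l1 (((N : ℤ) • (0 : Site D)) - (N : ℤ) • z) = (N : ℝ) * l1 z := by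
    rw [smul_zero, zero_sub, ← smul_neg, l1_natSmul]
    congr 1
    simpa using l1_sub_symm (0 : Site D) z
  have hz := l1_nonneg z
  have hN' : (1 : ℝ) ≤ N := by exact_mod_cast hN
  set E := Real.exp (-(δ / 2 / 2) * l1 (((N : ℤ) • (0 : Site D)) - (N : ℤ) • z)) with hEdef
  set E' := Real.exp (-(δ / 4) * l1 z) with hE'def
  have hE : 0 ≤ E := (Real.exp_pos _).le
  have hmul : l1 z ≤ (N : ℝ) * l1 z := le_mul_of_one_le_left hz hN'
  have hmul' : δ / 4 * l1 z ≤ δ / 4 * ((N : ℝ) * l1 z) := mul_le_mul_of_nonneg_left hmul (by linarith)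
  have hnn : 0 ≤ δ / 4 * ((N : ℝ) * l1 z) := mul_nonneg (by linarith) (mul_nonneg (by linarith) hz)
  have hEE' : E ≤ E' := by
    rw [hEdef, hE'def, hdist, Real.exp_le_exp]; linarith
  have hE1 : E ≤ 1 := by
    rw [hEdef, Real.exp_le_one_iff, hdist]; linarith
  have ht' : |tadpole A (W μ 0 ν z)| ≤ Kt * E' := ht.trans (mul_le_mul_of_nonneg_left hEE' hKt)
  have hb' : |bubble A (V μ 0) (V ν z)| ≤ Kb * E' := by
    refine hb.trans ?_
    have hrw : cF * (cF * ((cF * (C * Cv) * ZA) * (cF * (C * Cv) * ZA)) * ZB * E) * ZB * E = Kb * (E * E) := by ring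
    rw [hrw]
    refine mul_le_mul_of_nonneg_left ?_ hKb
    calc E * E ≤ E * 1 := mul_le_mul_of_nonneg_left hE1 hE
      _ ≤ E' := by rw [mul_one]; exact hEE'
  unfold hessKer
  calc |1 / 2 * tadpole A (W μ 0 ν z) - 1 / 2 * bubble A (V μ 0) (V ν z)|
      ≤ |1 / 2 * tadpole A (W μ 0 ν z)| + |1 / 2 * bubble A (V μ 0) (V ν z)| := abs_sub _ _
    _ = 1 / 2 * |tadpole A (W μ 0 ν z)| + 1 / 2 * |bubble A (V μ 0) (V ν z)| := by
        rw [abs_mul, abs_mul, abs_of_pos (by norm_num : (0 : ℝ) < 1 / 2)]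
    _ ≤ 1 / 2 * (Kt * E') + 1 / 2 * (Kb * E') := by gcongr
    _ = (1 / 2 * Kt + 1 / 2 * Kb) * E' := by ring

/-- **THE (T-def) SLOT IS WELL-TYPED**: the resolvent Hessian kernel has absolutely summable second moments (`AbsMoment₂`), entry by
entry — the hypothesis `hTA` of `HidentScalewise` / `ScalewiseVectorSeam` for `𝒯 := hessKer A V W`. [folklore] -/
theorem absMoment₂_hessKer {A : MKer D F} {V : Fin D → Site D → MKer D F} {W : Fin D → Site D → Fin D → Site D → MKer D F}
    {C Cv Cw δ : ℝ} {N : ℕ} (hA : Decays A C δ) (hV : VertexFamily V N Cv δ) (hW : VertexFamily₂ W N Cw δ) (hδ : 0 < δ)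
    (hN : 1 ≤ N) (μ ν : Fin D) : AbsMoment₂ (hessKer A V W μ ν) := by
  obtain ⟨C', _, h⟩ := decay510_hessKer hA hV hW hδ hN μ ν
  exact absMoment₂_of_decay510 (by linarith) h

/-! ## §6 (v1.1) Block-translation covariance: the base point `0` represents every base point -/

/-- Simultaneous SHIFT of both arguments of a kernel by `v`. [folklore] -/
def shiftK (v : Site D) (K : MKer D F) : MKer D F := fun x y => K (x + v) (y + v)

/-- Composition commutes with simultaneous shifts (re-indexing the middle `tsum` by `y ↦ y + v`). [folklore] -/
theorem comp_shiftK (v : Site D) (A K : MKer D F) : comp (shiftK v A) (shiftK v K) = shiftK v (comp A K) := by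
  funext x z a b
  unfold comp shiftK
  exact (Equiv.addRight v).tsum_eq (fun y : Site D => ∑ f, A (x + v) y a f * K y (z + v) f b)

/-- The trace is invariant under simultaneous shifts. [folklore] -/
theorem tr_shiftK (v : Site D) (K : MKer D F) : tr (shiftK v K) = tr K := by
  unfold tr shiftK
  exact (Equiv.addRight v).tsum_eq (fun x : Site D => ∑ a, K x x a a)

/-- The bubble is invariant under simultaneous shifts of all three kernels. [folklore] -/
theorem bubble_shiftK (v : Site D) (A V W : MKer D F) : bubble (shiftK v A) (shiftK v V) (shiftK v W) = bubble A V W := by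
  unfold bubble
  rw [comp_shiftK, comp_shiftK, comp_shiftK, tr_shiftK]

/-- The tadpole is invariant under simultaneous shifts. [folklore] -/
theorem tadpole_shiftK (v : Site D) (A W₂ : MKer D F) : tadpole (shiftK v A) (shiftK v W₂) = tadpole A W₂ := by
  unfold tadpole
  rw [comp_shiftK, tr_shiftK]

/-- BLOCK-TRANSLATION COVARIANCE of the data: `A` is invariant under simultaneous shifts by coarse vectors `N • t`, and the vertex
families transform by `V μ (y + t) = shiftK (−N•t) (V μ y)`, `W μ (y+t) ν (y′+t) = shiftK (−N•t) (W μ y ν y′)`. [folklore] -/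
structure BlockCovariant (A : MKer D F) (V : Fin D → Site D → MKer D F) (W : Fin D → Site D → Fin D → Site D → MKer D F) (N : ℕ) :
    Prop where
  covA : ∀ t : Site D, shiftK (-((N : ℤ) • t)) A = A
  covV : ∀ (μ : Fin D) (y t : Site D), V μ (y + t) = shiftK (-((N : ℤ) • t)) (V μ y)
  covW : ∀ (μ : Fin D) (y : Site D) (ν : Fin D) (y' t : Site D), W μ (y + t) ν (y' + t) = shiftK (-((N : ℤ) • t)) (W μ y ν y')

/-- The resolvent Hessian at a GENERAL pair of coarse bonds. [folklore] -/
def hess (A : MKer D F) (V : Fin D → Site D → MKer D F) (W : Fin D → Site D → Fin D → Site D → MKer D F)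
    (μ : Fin D) (y : Site D) (ν : Fin D) (y' : Site D) : ℝ :=
  (1 / 2) * tadpole A (W μ y ν y') - (1 / 2) * bubble A (V μ y) (V ν y')

/-- **COVARIANCE**: under `BlockCovariant`, `hess μ (y+t) ν (y′+t) = hess μ y ν y′`. [folklore] -/
theorem hess_translate {A : MKer D F} {V : Fin D → Site D → MKer D F} {W : Fin D → Site D → Fin D → Site D → MKer D F} {N : ℕ}
    (h : BlockCovariant A V W N) (μ : Fin D) (y : Site D) (ν : Fin D) (y' t : Site D) :
    hess A V W μ (y + t) ν (y' + t) = hess A V W μ y ν y' := by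
  unfold hess
  rw [h.covW, h.covV, h.covV]
  conv_lhs => rw [← h.covA t]
  rw [tadpole_shiftK, bubble_shiftK]

/-- **THE BASE POINT `0` REPRESENTS EVERY BASE POINT**: under `BlockCovariant`, `hess μ y ν y′ = hessKer μ ν (y′ − y)`. [folklore] -/
theorem hess_eq_hessKer {A : MKer D F} {V : Fin D → Site D → MKer D F} {W : Fin D → Site D → Fin D → Site D → MKer D F} {N : ℕ}
    (h : BlockCovariant A V W N) (μ : Fin D) (y : Site D) (ν : Fin D) (y' : Site D) :
    hess A V W μ y ν y' = hessKer A V W μ ν (y' - y) := by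
  have := hess_translate h μ 0 ν (y' - y) y
  rw [zero_add, sub_add_cancel] at this
  rw [this]
  rfl

/-! ## §7 (v1.3) One decay constant for all channels — the `hdec` slot of the printed-symmetries END corollary -/

omit [Fintype F] in
/-- `Decay510` is monotone in the constant. [folklore] -/
theorem decay510_mono_const {f : Site D → ℝ} {C C' δ : ℝ} (h : Decay510 f C δ) (hCC' : C ≤ C') : Decay510 f C' δ :=
  fun x => (h x).trans (mul_le_mul_of_nonneg_right hCC' (Real.exp_pos _).le)

/-- **UNIFORM (5.10)-TYPE DECAY OF THE RESOLVENT HESSIAN KERNEL**: one constant `C'` for all channels `(μ, ν)`, rate `δ/4` — the shape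
`∃ C δ, 0 < δ ∧ ∀ μ ν, Decay510 (T μ ν) C δ` asked per step by `ScalewiseVectorSeam.endpointExistence_of_scalewise_vectorSeam_printed`
(there `T j := hessKer …`; `PolarizationSign.momentSummable_of_decay510` and `DecimatedMomentSummable.absMoment₂_of_decay510` then give all
moments). [folklore] -/
theorem decay510_hessKer_uniform {A : MKer D F} {V : Fin D → Site D → MKer D F} {W : Fin D → Site D → Fin D → Site D → MKer D F}
    {C Cv Cw δ : ℝ} {N : ℕ} (hA : Decays A C δ) (hV : VertexFamily V N Cv δ) (hW : VertexFamily₂ W N Cw δ) (hδ : 0 < δ)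
    (hN : 1 ≤ N) :
    ∃ C' : ℝ, 0 ≤ C' ∧ ∀ μ ν : Fin D, Decay510 (hessKer A V W μ ν) C' (δ / 4) := by
  classical
  choose Cc hCc0 hCc using fun p : Fin D × Fin D => decay510_hessKer hA hV hW hδ hN p.1 p.2
  refine ⟨∑ p : Fin D × Fin D, Cc p, Finset.sum_nonneg fun p _ => hCc0 p, fun μ ν => ?_⟩
  exact decay510_mono_const (hCc (μ, ν)) (Finset.single_le_sum (fun p _ => hCc0 p) (Finset.mem_univ (μ, ν)))

/-- Packaged for the END corollary's binder shape: `∃ C δ', 0 < δ' ∧ ∀ μ ν, Decay510 (hessKer A V W μ ν) C δ'`. [folklore] -/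
theorem hdec_hessKer {A : MKer D F} {V : Fin D → Site D → MKer D F} {W : Fin D → Site D → Fin D → Site D → MKer D F}
    {C Cv Cw δ : ℝ} {N : ℕ} (hA : Decays A C δ) (hV : VertexFamily V N Cv δ) (hW : VertexFamily₂ W N Cw δ) (hδ : 0 < δ)
    (hN : 1 ≤ N) :
    ∃ C' δ' : ℝ, 0 < δ' ∧ ∀ μ ν : Fin D, Decay510 (hessKer A V W μ ν) C' δ' := by
  obtain ⟨C', -, h⟩ := decay510_hessKer_uniform hA hV hW hδ hN
  exact ⟨C', δ / 4, by positivity, h⟩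

end Literature.MathematicalPhysics.QuantumFieldTheory.Balaban1983to89.Beta.ExpKernelCalculus
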